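import Literature.NumberTheory.ConnesMoscovici2022.UVProlateEigenfunctionAsymptotics
import HarnessLib

/-!
# Connes–Moscovici 2022, §1: Green's formula for a pair of eigen-representatives with two eigenvalues

Topic `Literature/NumberTheory/ConnesMoscovici2022`.  Support module toward the symmetry of `W_sa` on
its eigenvectors ([ConnesMoscovici2022, Thm 1.6 (i)], and the finite-multiplicity clause of Thm 5.1):
for `g₁, g₂` smooth off `±λ` with `(p gᵢ′)′ = (q − μᵢ) gᵢ` (`μᵢ ∈ ℝ`), the mixed Wronskian
`𝒲 = p (ḡ₂′ g₁ − g₁′ ḡ₂)` satisfies the Lagrange identity `𝒲′ = (μ₁ − μ₂) g₁ ḡ₂`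
([ConnesMoscovici2022, (1.5)]), hence Green's formula `(μ₁ − μ₂) ∫_a^b g₁ ḡ₂ = 𝒲(b) − 𝒲(a)` on
intervals avoiding `±λ` ((1.7)); and `𝒲 → 0` at `λ^±` under the boundary condition (1.19) with one-sided
limits, and at `+∞` under the (even-sector) asymptotics `x gᵢ − Aᵢ sin(ωx) → 0`,
`gᵢ + x gᵢ′ − ωAᵢ cos(ωx) → 0` of `CM22_cor_1_7_strong`.  The remaining integral bookkeeping
(`⟪φ₁, φ₂⟫ = 0` for a.e.-even eigenvectors with `μ₁ ≠ μ₂`) is left to a sequel.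
RH-FREE; nothing here bears on the truth of RH.
-/

noncomputable section

open Complex Set MeasureTheory Filter Topology intervalIntegral
open scoped Real Topology ContDiff ComplexConjugate

namespace Literature.NumberTheory.ConnesMoscovici2022

open Literature.NumberTheory.ConnesConsani2024

variable {lam : ℝ}

/-- `S = ℝ ∖ {±λ}` is open (plumbing). [folklore] -/
private theorem isOpen_S4 (lam : ℝ) : IsOpen {x : ℝ | x ≠ lam ∧ x ≠ -lam} := isOpen_ne.and isOpen_ne

/-- **Lagrange identity with two eigenvalues** ([ConnesMoscovici2022, (1.5)] for `ξ = g₁`, `η = ḡ₂`,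
`W g₁ = μ₁ g₁`, `W g₂ = μ₂ g₂`): the mixed Wronskian `p (ḡ₂′ g₁ − g₁′ ḡ₂)` has derivative
`(μ₁ − μ₂) g₁ ḡ₂`. [cite: ConnesMoscovici2022, §1 eq. (1.5) (= arXiv:2112.05500 (2.5), chunk p0005:L24–L27)] -/
theorem hasDerivAt_mixed_wronskian (lam μ₁ μ₂ : ℝ) {g₁ g₂ : ℝ → ℂ} {x : ℝ}
    (hg₁ : HasDerivAt g₁ (deriv g₁ x) x) (hg₂ : HasDerivAt g₂ (deriv g₂ x) x)
    (hu₁ : HasDerivAt (fun y => pCoeff lam y * deriv g₁ y) ((qCoeff lam x - μ₁) * g₁ x) x)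
    (hu₂ : HasDerivAt (fun y => pCoeff lam y * deriv g₂ y) ((qCoeff lam x - μ₂) * g₂ x) x) :
    HasDerivAt (fun y => conj (pCoeff lam y * deriv g₂ y) * g₁ y - pCoeff lam y * deriv g₁ y * conj (g₂ y))
      (((μ₁ - μ₂ : ℝ) : ℂ) * (g₁ x * conj (g₂ x))) x := by
  have h := (hu₂.star.fun_mul hg₁).fun_sub (hu₁.fun_mul hg₂.star)
  refine h.congr_deriv ?_
  simp only [star_def, map_mul, map_sub]
  rw [qCoeff, pCoeff, Complex.conj_ofReal, Complex.conj_ofReal, Complex.conj_ofReal]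
  push_cast
  ring

/-- **Green's formula on an interval avoiding `±λ`**: `(μ₁ − μ₂) ∫_a^b g₁ ḡ₂ = 𝒲(b) − 𝒲(a)`.
[cite: ConnesMoscovici2022, §1 eq. (1.7) (= arXiv:2112.05500 (2.7), chunk p0005:L33–L40)] -/
theorem green_mixed (lam μ₁ μ₂ : ℝ) {g₁ g₂ : ℝ → ℂ}
    (hsm₁ : ContDiffOn ℝ ∞ g₁ {x | x ≠ lam ∧ x ≠ -lam})
    (hsm₂ : ContDiffOn ℝ ∞ g₂ {x | x ≠ lam ∧ x ≠ -lam})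
    (hu₁ : ∀ x ∈ {x : ℝ | x ≠ lam ∧ x ≠ -lam},
      HasDerivAt (fun y => pCoeff lam y * deriv g₁ y) ((qCoeff lam x - μ₁) * g₁ x) x)
    (hu₂ : ∀ x ∈ {x : ℝ | x ≠ lam ∧ x ≠ -lam},
      HasDerivAt (fun y => pCoeff lam y * deriv g₂ y) ((qCoeff lam x - μ₂) * g₂ x) x)
    {a b : ℝ} (hab : uIcc a b ⊆ {x : ℝ | x ≠ lam ∧ x ≠ -lam}) :
    ((μ₁ - μ₂ : ℝ) : ℂ) * ∫ x in a..b, g₁ x * conj (g₂ x) =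
      (conj (pCoeff lam b * deriv g₂ b) * g₁ b - pCoeff lam b * deriv g₁ b * conj (g₂ b)) -
      (conj (pCoeff lam a * deriv g₂ a) * g₁ a - pCoeff lam a * deriv g₁ a * conj (g₂ a)) := by
  have hS := isOpen_S4 lam
  have hgd : ∀ (g : ℝ → ℂ), ContDiffOn ℝ ∞ g {x | x ≠ lam ∧ x ≠ -lam} →
      ∀ x ∈ {x : ℝ | x ≠ lam ∧ x ≠ -lam}, HasDerivAt g (deriv g x) x := fun g hg x hx =>
    ((hg.differentiableOn (by simp) x hx).differentiableAt (hS.mem_nhds hx)).hasDerivAt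
  have hderiv : ∀ x ∈ uIcc a b, HasDerivAt
      (fun y => conj (pCoeff lam y * deriv g₂ y) * g₁ y - pCoeff lam y * deriv g₁ y * conj (g₂ y))
      (((μ₁ - μ₂ : ℝ) : ℂ) * (g₁ x * conj (g₂ x))) x := fun x hx =>
    hasDerivAt_mixed_wronskian lam μ₁ μ₂ (hgd g₁ hsm₁ x (hab hx)) (hgd g₂ hsm₂ x (hab hx))
      (hu₁ x (hab hx)) (hu₂ x (hab hx))
  have hcont : ContinuousOn (fun x => ((μ₁ - μ₂ : ℝ) : ℂ) * (g₁ x * conj (g₂ x))) (uIcc a b) :=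
    continuousOn_const.mul ((hsm₁.continuousOn.mono hab).mul
      ((Complex.continuous_conj.comp_continuousOn (hsm₂.continuousOn.mono hab))))
  rw [← intervalIntegral.integral_const_mul]
  exact (integral_eq_sub_of_hasDerivAt hderiv hcont.intervalIntegrable)

/-- **The mixed Wronskian tends to `0` along a filter where the boundary condition (1.19) holds and the
functions have limits** (e.g. `𝓝[>] λ`, `𝓝[<] λ` for eigen-representatives).
[cite: ConnesMoscovici2022, §1 (1.19) (= arXiv:2112.05500 (2.19), chunk p0006:L55–L58)] -/
theorem tendsto_mixed_wronskian_of_bc {g₁ g₂ : ℝ → ℂ} {l : Filter ℝ}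
    (hbc₁ : Tendsto (fun x => pCoeff lam x * deriv g₁ x) l (𝓝 0))
    (hbc₂ : Tendsto (fun x => pCoeff lam x * deriv g₂ x) l (𝓝 0))
    {c₁ c₂ : ℂ} (hl₁ : Tendsto g₁ l (𝓝 c₁)) (hl₂ : Tendsto g₂ l (𝓝 c₂)) :
    Tendsto (fun x => conj (pCoeff lam x * deriv g₂ x) * g₁ x - pCoeff lam x * deriv g₁ x * conj (g₂ x))
      l (𝓝 0) := by
  have h₂' : Tendsto (fun x => conj (pCoeff lam x * deriv g₂ x)) l (𝓝 0) := by
    have := (Complex.continuous_conj.tendsto 0).comp hbc₂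
    rwa [Function.comp_def, map_zero] at this
  have hc₂ : Tendsto (fun x => conj (g₂ x)) l (𝓝 (conj c₂)) :=
    (Complex.continuous_conj.tendsto c₂).comp hl₂
  have h := (h₂'.mul hl₁).sub (hbc₁.mul hc₂)
  rw [zero_mul, zero_mul, sub_zero] at h
  exact h

/-- **The mixed Wronskian tends to `0` at `+∞`** under the even-sector asymptotics of
`CM22_cor_1_7_strong`: `x gᵢ − Aᵢ sin(ωx) → 0`, `gᵢ + x gᵢ′ − ωAᵢ cos(ωx) → 0` (`ω = 2πλ`).  Indeed
`𝒲(x) = (λ²/x² − 1)(v̄₂′ v₁ − v₁′ v̄₂)` with `vᵢ = x gᵢ`, `vᵢ′ = gᵢ + x gᵢ′`, and the bracket tends to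
`ω Ā₂ A₁ (cos·sin − sin·cos) = 0`.
[cite: ConnesMoscovici2022, §1 (1.20), Cor 1.7 (ii) (= arXiv:2112.05500 (2.20), Cor 2.7, chunk p0006:L64–L66, L116–L123)] -/
theorem tendsto_mixed_wronskian_atTop {g₁ g₂ : ℝ → ℂ} {A₁ A₂ : ℂ}
    (hv₁ : Tendsto (fun x : ℝ => (x : ℂ) * g₁ x - A₁ * (Real.sin (2 * π * lam * x) : ℂ)) atTop (𝓝 0))
    (hv₁' : Tendsto (fun x : ℝ => (g₁ x + x * deriv g₁ x) -
      ((2 * π * lam : ℝ) : ℂ) * A₁ * (Real.cos (2 * π * lam * x) : ℂ)) atTop (𝓝 0))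
    (hv₂ : Tendsto (fun x : ℝ => (x : ℂ) * g₂ x - A₂ * (Real.sin (2 * π * lam * x) : ℂ)) atTop (𝓝 0))
    (hv₂' : Tendsto (fun x : ℝ => (g₂ x + x * deriv g₂ x) -
      ((2 * π * lam : ℝ) : ℂ) * A₂ * (Real.cos (2 * π * lam * x) : ℂ)) atTop (𝓝 0)) :
    Tendsto (fun x => conj (pCoeff lam x * deriv g₂ x) * g₁ x - pCoeff lam x * deriv g₁ x * conj (g₂ x))
      atTop (𝓝 0) := by
  set w : ℝ := 2 * π * lam with hw
  -- abbreviations for the error terms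
  set e₁ : ℝ → ℂ := fun x => (x : ℂ) * g₁ x - A₁ * (Real.sin (w * x) : ℂ) with he₁
  set e₂ : ℝ → ℂ := fun x => (x : ℂ) * g₂ x - A₂ * (Real.sin (w * x) : ℂ) with he₂
  set f₁ : ℝ → ℂ := fun x => (g₁ x + x * deriv g₁ x) - (w : ℂ) * A₁ * (Real.cos (w * x) : ℂ) with hf₁
  set f₂ : ℝ → ℂ := fun x => (g₂ x + x * deriv g₂ x) - (w : ℂ) * A₂ * (Real.cos (w * x) : ℂ) with hf₂
  have he₁t : Tendsto e₁ atTop (𝓝 0) := by simpa only [he₁, hw] using hv₁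
  have he₂t : Tendsto e₂ atTop (𝓝 0) := by simpa only [he₂, hw] using hv₂
  have hf₁t : Tendsto f₁ atTop (𝓝 0) := by
    simpa only [hf₁, hw, Complex.ofReal_mul, Complex.ofReal_ofNat] using hv₁'
  have hf₂t : Tendsto f₂ atTop (𝓝 0) := by
    simpa only [hf₂, hw, Complex.ofReal_mul, Complex.ofReal_ofNat] using hv₂'
  -- the bracket  B = conj(v₂′) v₁ − v₁′ conj(v₂)  in terms of the error terms
  set B : ℝ → ℂ := fun x => conj (g₂ x + x * deriv g₂ x) * ((x : ℂ) * g₁ x) -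
    (g₁ x + x * deriv g₁ x) * conj ((x : ℂ) * g₂ x) with hB
  have hBid : ∀ x : ℝ, B x = conj (f₂ x + (w : ℂ) * A₂ * (Real.cos (w * x) : ℂ)) * (e₁ x + A₁ * (Real.sin (w * x) : ℂ))
      - (f₁ x + (w : ℂ) * A₁ * (Real.cos (w * x) : ℂ)) * conj (e₂ x + A₂ * (Real.sin (w * x) : ℂ)) := by
    intro x; rw [hB, he₁, he₂, hf₁, hf₂]; dsimp only; ring_nf
  have hBid' : ∀ x : ℝ, B x = conj (f₂ x) * e₁ x + conj (f₂ x) * (A₁ * (Real.sin (w * x) : ℂ))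
      + (w : ℂ) * conj A₂ * (Real.cos (w * x) : ℂ) * e₁ x
      - f₁ x * conj (e₂ x) - f₁ x * (conj A₂ * (Real.sin (w * x) : ℂ))
      - (w : ℂ) * A₁ * (Real.cos (w * x) : ℂ) * conj (e₂ x) := by
    intro x
    rw [hBid x]
    simp only [map_add, map_mul, Complex.conj_ofReal]
    ring
  have hBt : Tendsto B atTop (𝓝 0) := by
    have hsin : ∀ x : ℝ, ‖(Real.sin (w * x) : ℂ)‖ ≤ 1 := fun x => by
      rw [Complex.norm_real, Real.norm_eq_abs]; exact Real.abs_sin_le_one _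
    have hcos : ∀ x : ℝ, ‖(Real.cos (w * x) : ℂ)‖ ≤ 1 := fun x => by
      rw [Complex.norm_real, Real.norm_eq_abs]; exact Real.abs_cos_le_one _
    -- each of the six terms tends to 0 (zero × bounded)
    have hcf₂ : Tendsto (fun x => conj (f₂ x)) atTop (𝓝 0) := by
      have := (Complex.continuous_conj.tendsto 0).comp hf₂t; rwa [Function.comp_def, map_zero] at this
    have hce₂ : Tendsto (fun x => conj (e₂ x)) atTop (𝓝 0) := by
      have := (Complex.continuous_conj.tendsto 0).comp he₂t; rwa [Function.comp_def, map_zero] at this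
    have bdd_mul_zero : ∀ {u b : ℝ → ℂ} (C : ℝ), Tendsto u atTop (𝓝 0) → (∀ x, ‖b x‖ ≤ C) →
        Tendsto (fun x => u x * b x) atTop (𝓝 0) := by
      intro u b C hu hb
      rw [tendsto_zero_iff_norm_tendsto_zero] at hu ⊢
      have hC : 0 ≤ C := (norm_nonneg _).trans (hb 0)
      refine squeeze_zero (fun x => norm_nonneg _) (fun x => ?_) (by simpa using hu.mul_const C)
      rw [norm_mul]; exact mul_le_mul_of_nonneg_left (hb x) (norm_nonneg _)
    have t1 : Tendsto (fun x => conj (f₂ x) * e₁ x) atTop (𝓝 0) := by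
      simpa using hcf₂.mul he₁t
    have t2 : Tendsto (fun x => conj (f₂ x) * (A₁ * (Real.sin (w * x) : ℂ))) atTop (𝓝 0) :=
      bdd_mul_zero ‖A₁‖ hcf₂ fun x => by
        rw [norm_mul]; exact mul_le_of_le_one_right (norm_nonneg _) (hsin x)
    have t3 : Tendsto (fun x => (w : ℂ) * conj A₂ * (Real.cos (w * x) : ℂ) * e₁ x) atTop (𝓝 0) := by
      have := bdd_mul_zero (‖(w : ℂ) * conj A₂‖) he₁t (b := fun x => (w : ℂ) * conj A₂ * (Real.cos (w * x) : ℂ))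
        fun x => by rw [norm_mul]; exact mul_le_of_le_one_right (norm_nonneg _) (hcos x)
      refine this.congr fun x => ?_; ring
    have t4 : Tendsto (fun x => f₁ x * conj (e₂ x)) atTop (𝓝 0) := by
      simpa using hf₁t.mul hce₂
    have t5 : Tendsto (fun x => f₁ x * (conj A₂ * (Real.sin (w * x) : ℂ))) atTop (𝓝 0) :=
      bdd_mul_zero ‖conj A₂‖ hf₁t fun x => by
        rw [norm_mul]; exact mul_le_of_le_one_right (norm_nonneg _) (hsin x)
    have t6 : Tendsto (fun x => (w : ℂ) * A₁ * (Real.cos (w * x) : ℂ) * conj (e₂ x)) atTop (𝓝 0) := by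
      have := bdd_mul_zero (‖(w : ℂ) * A₁‖) hce₂ (b := fun x => (w : ℂ) * A₁ * (Real.cos (w * x) : ℂ))
        fun x => by rw [norm_mul]; exact mul_le_of_le_one_right (norm_nonneg _) (hcos x)
      refine this.congr fun x => ?_; ring
    have h := ((((t1.add t2).add t3).sub t4).sub t5).sub t6
    simp only [add_zero, sub_zero] at h
    refine h.congr fun x => ?_
    rw [hBid' x]
  -- 𝒲(x) = (λ²/x² − 1) · B(x) for x ≠ 0
  have hWid : ∀ x : ℝ, x ≠ 0 →
      conj (pCoeff lam x * deriv g₂ x) * g₁ x - pCoeff lam x * deriv g₁ x * conj (g₂ x) =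
        (((lam ^ 2 / x ^ 2 - 1 : ℝ)) : ℂ) * B x := by
    intro x hx
    have hxC : (x : ℂ) ≠ 0 := Complex.ofReal_ne_zero.2 hx
    rw [hB, pCoeff]; dsimp only
    simp only [map_mul, map_add, Complex.conj_ofReal]
    push_cast
    field_simp
    ring
  have hcoef : Tendsto (fun x : ℝ => (((lam ^ 2 / x ^ 2 - 1 : ℝ)) : ℂ)) atTop (𝓝 ((-1 : ℝ) : ℂ)) := by
    refine (Complex.continuous_ofReal.tendsto _).comp ?_
    have h1 : Tendsto (fun x : ℝ => lam ^ 2 / x ^ 2) atTop (𝓝 0) := by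
      have := (tendsto_pow_atTop (n := 2) (α := ℝ) two_ne_zero).inv_tendsto_atTop.const_mul (lam ^ 2)
      simpa [div_eq_mul_inv] using this
    simpa using h1.sub_const 1
  have h := hcoef.mul hBt
  rw [mul_zero] at h
  refine h.congr' ?_
  filter_upwards [eventually_gt_atTop 0] with x hx
  exact (hWid x hx.ne').symm

end Literature.NumberTheory.ConnesMoscovici2022
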